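import Summits.Ventures.PercRepro.RankLevelSetExplicitLin2Band
import Summits.Ventures.PercRepro.RankLevelSetExplicitLin2BandFloor

/-!
# PercRepro — THE BAND BELOW ANY FLOOR TABLE: THE OPEN PART OF C-025 IS ITS BAND CELLS BELOW ANY TABLE OF ROWS (p9, S4)

`proofs/SUBCLAIM-S4-p9.md` §S4.2⁗‴. RankLevelSetExplicitLin2BandFloor cuts the band of open core cells (`BandOpen`,
RankLevelSetExplicitLin2Band) at the saturated floor table `Pfloor`. Here the cut is made at ANY table `P : ℕ → ℕ` of
row thresholds (`RLS M p q` for every `p ≥ P q` at every `q ≥ 7`; no bound on `P` is needed): `BandOpenBelow P q p d :=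
p < P q ∧ BandOpen q p d`, every core cell outside it is closed (`rls_core_of_not_bandBelow`), and the crux is its band
cells below the table (`c025_of_bandBelow_cells`, `c025_iff_bandBelow_cells`) — the instances for the cubic and quartic
tables `PfloorC` / `PfloorQ` (RankLevelSetExplicitLin2CubeFloor / QuartFloor) are RankLevelSetExplicitLin2BandBelowTables.
`BandOpenFloor` is the instance `P = Pfloor` (`bandOpenFloor_iff`). Axioms: standard.
-/

open scoped Matroid

namespace PercRepro

namespace ThmN

variable {α : Type}

/-- **THE BAND BELOW A TABLE**: a band cell (`BandOpen`) of rank `p < P q`. -/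
def BandOpenBelow (P : ℕ → ℕ) (q p d : ℕ) : Prop := p < P q ∧ BandOpen q p d

/-- `BandOpenFloor` is the band below the saturated table `Pfloor`. -/
theorem bandOpenFloor_iff (q p d : ℕ) : BandOpenFloor q p d ↔ BandOpenBelow Pfloor q p d := Iff.rfl

/-- From the table's rank on, the band is empty. -/
theorem not_bandOpenBelow_of_le (P : ℕ → ℕ) (q p d : ℕ) (hp : P q ≤ p) : ¬ BandOpenBelow P q p d := fun h => by
  have := h.1
  omega

/-- **EVERY CORE CELL OUTSIDE THE BAND BELOW A TABLE OF ROWS IS CLOSED** (level `q ≥ 8`): `rls_core_of_not_band` below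
the table, the table's row from it on. -/
theorem rls_core_of_not_bandBelow (P : ℕ → ℕ)
    (hP : ∀ q, 7 ≤ q → ∀ {α : Type} (M : Matroid α) [M.Finite] (p : ℕ), P q ≤ p → RLS M p q)
    (q : ℕ) (hq : 8 ≤ q) (M : Matroid α) [M.Finite] (p d : ℕ)
    (hR : M.eRank = (p : ℕ∞)) (hn : M.E.ncard = p + d)
    (hfree : ∀ e ∈ M.E, ∃ A ⊆ M.E \ {e}, e ∉ M.closure A ∧ e ∉ M.closure ((M.E \ {e}) \ A))
    (hb : ¬ BandOpenBelow P q p d) : RLS M p q := by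
  by_cases hp : p < P q
  · exact rls_core_of_not_band q hq M p d hR hn hfree (fun h => hb ⟨hp, h⟩)
  · exact hP q (by omega) M p (by omega)

/-- **THE CRUX IS ITS BAND CELLS BELOW A TABLE OF ROWS**: for a table `P` with `RLS M p q`
for every `p ≥ P q` at every `q ≥ 7` (no bound on `P` is needed: below level `7` the band condition is vacuous), `C025` follows from the simple, coloop-free, `e`-free core cells `(p, n)` with
`q + 2 ≤ p ≤ q·2^{q+1}`, `n < Nexp p q` (`q ≥ 4`) whose corank lies in the band below the table at every level `q ≥ 8`. -/
theorem c025_of_bandBelow_cells (P : ℕ → ℕ)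
    (hP : ∀ q, 7 ≤ q → ∀ {α : Type} (M : Matroid α) [M.Finite] (p : ℕ), P q ≤ p → RLS M p q)
    (hcells : ∀ q, 4 ≤ q → ∀ {α : Type} (M : Matroid α) [M.Finite] (p : ℕ), q + 2 ≤ p → p ≤ q * 2 ^ (q + 1) →
      M.E.ncard < Nexp p q → (∀ e ∈ M.E, ∀ f ∈ M.E, e ≠ f → M.eRk {e, f} = 2) → M.eRank = (p : ℕ∞) →
      (∀ e, ¬ M.IsColoop e) →
      (∀ e ∈ M.E, ∃ A ⊆ M.E \ {e}, e ∉ M.closure A ∧ e ∉ M.closure ((M.E \ {e}) \ A)) →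
      (8 ≤ q → BandOpenBelow P q p (M.E.ncard - p)) → RLS M p q) : C025 := by
  refine c025_of_band_cells ?_
  intro q hq β M _ p hpq hpP hn hs hR hc hfree hb
  by_cases hp : p < P q
  · exact hcells q hq M p hpq hpP hn hs hR hc hfree (fun h8 => ⟨hp, hb h8⟩)
  · rcases Nat.lt_or_ge q 7 with h7 | h7
    · exact hcells q hq M p hpq hpP hn hs hR hc hfree (fun h8 => absurd h8 (by omega))
    · exact hP q h7 M p (by omega)

/-- **THE CRUX IS ITS BAND CELLS BELOW A TABLE OF ROWS** (both directions). -/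
theorem c025_iff_bandBelow_cells (P : ℕ → ℕ)
    (hP : ∀ q, 7 ≤ q → ∀ {α : Type} (M : Matroid α) [M.Finite] (p : ℕ), P q ≤ p → RLS M p q) :
    C025 ↔ (∀ q, 4 ≤ q → ∀ {α : Type} (M : Matroid α) [M.Finite] (p : ℕ), q + 2 ≤ p → p ≤ q * 2 ^ (q + 1) →
      M.E.ncard < Nexp p q → (∀ e ∈ M.E, ∀ f ∈ M.E, e ≠ f → M.eRk {e, f} = 2) → M.eRank = (p : ℕ∞) →
      (∀ e, ¬ M.IsColoop e) →
      (∀ e ∈ M.E, ∃ A ⊆ M.E \ {e}, e ∉ M.closure A ∧ e ∉ M.closure ((M.E \ {e}) \ A)) →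
      (8 ≤ q → BandOpenBelow P q p (M.E.ncard - p)) → RLS M p q) :=
  ⟨fun h q _ _ M _ p hpq _ _ _ _ _ _ _ => h M p q hpq, c025_of_bandBelow_cells P hP⟩

end ThmN

end PercRepro
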